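import Literature.NumberTheory.IwasawaTheory.ClassicalMuVanishesQuadraticAscent
import Literature.NumberTheory.IwasawaTheory.ClassicalMuVanishesCyclicAscentOdd
import Literature.NumberTheory.NumberFields.HilbertTheorem92
import Mathlib.NumberTheory.NumberField.InfinitePlace.TotallyRealComplex
import HarnessLib

/-!
# Iwasawa's `μ = 0` ASCENDS a quadratic extension `K'/K` at `ℓ = 2` that is UNRAMIFIED AT THE INFINITE PLACES
# (e.g. `K'` and the base totally real): Chevalley with archimedean factor `1`, no unit-signature hypothesis
# (proved; no definition, no named fact)

`Proofs`-style file (theorems only) in topic `NumberTheory/IwasawaTheory` (namespace `Literature.NumberTheory.IwasawaTheory`), written by the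
prover seat `bsd-line-att-p3` g34 (cell `bsd-f1-sign2`; `--supports` stmt-BirchSwinnertonDyer-22298; closes nothing). It is the twin of
`ClassicalMuVanishesQuadraticAscent` (cell `bsd-2adic`): there the top field `K'` is TOTALLY COMPLEX, every real place of the layer
`A_n = j(K)·F_n` ramifies in `B_n = j'(K')·F_n`, and the archimedean factor `2^{r₁(A_n)}` of Chevalley's ambiguous class number formula has to be
cancelled by the unit signature index (hypothesis «the unit signature map of `A_n` is onto»). Here the OPPOSITE extreme is treated: `B_n/A_n`
UNRAMIFIED at every infinite place (every real place of `A_n` stays real in `B_n`; e.g. `F` and `K'` totally real, or `F` totally complex).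
Then the archimedean factor is `1` (tree `archFactor_eq_one`) and Chevalley's formula is the odd-prime-shaped inequality
`ord₂ #Cl(B_n)^G + 1 ≤ ord₂ h(A_n) + t_n` with NO hypothesis on units (tree `padicValNat_card_fixed_add_one_le_of_archFactor`); the rest of
the finite-level argument (bounded `2`-ranks downstairs ⟹ `rank₂ Cl(B_n) ≤ 2(2R + T)` ⟹ `μ = 0` upstairs, modules (G) and the tree's
«`μ = 0` iff bounded ranks») is unchanged. This is the `ℓ = 2` case of Iwasawa's 1973 ascent theorem in the one situation with real places
where his proviso «`k` totally imaginary if `ℓ = 2`» is not needed at all: nothing ramifies at infinity.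

* §1 `isTotallyReal_of_isUnramifiedAtInfinitePlaces`, `isTotallyReal_layer_of_isTotallyReal` (the layers of ANY `ℤ_p`-extension — `p = 2`
  included — of a totally real field are totally real: complex conjugations lie in `ker κ`), `isUnramifiedAtInfinitePlaces_of_isTotallyReal`,
  `isTotallyReal_fieldRange_sup_layer` (`j'(K')·F_n` is totally real for `K'`, `F` totally real).
* §2 ★ **`classicalMuVanishes_restrict_of_quadratic_of_isUnramifiedAtInfinitePlaces`** — `κ` a `ℤ₂`-extension of `F`; `K ⊆ K'` over `F`,
  `[K' : K] = 2`, `κ ∘ res` onto for both; for every `n`: at most `T` primes of `A_n` ramify in `B_n` and `B_n/A_n` is unramified at the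
  infinite places ⟹ (`ClassicalMuVanishes (κ|_K) ⟹ ClassicalMuVanishes (κ|_{K'})`).
* §3 ★ **`classicalMuVanishes_restrict_of_quadratic_of_isTotallyReal`** — the same with the archimedean hypothesis discharged by
  «`F` and `K'` totally real» (then every `B_n = j'(K')·F_n` is totally real).
* §4 BASE FORM (`K = F`, layers `F_n ⊆ j'(K')·F_n`, the `p = 2` twin of `ClassicalMuVanishesCyclicAscentOdd`):
  `classGroupPRank_restrict_le_of_finrank_eq_two_of_isUnramifiedAtInfinitePlaces` (per layer, no `μ`-hypothesis:
  `rank₂ Cl((K'F_∞)_n) ≤ 2·(2·rank₂ Cl(F_n) + T)`), ★ `classicalMuVanishes_restrict_of_finrank_eq_two_of_isUnramifiedAtInfinitePlaces`,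
  ★ `classicalMuVanishes_restrict_of_finrank_eq_two_of_isTotallyReal` (`F`, `K'` totally real, `[K' : F] = 2`).

Intended use (cell bsd-f1-sign2, crux C2 `MainConjectureOfRankZeroBSDAtTwo`): `F = K = ℚ`, `K' = ℚ(√Δ_W)` the REAL quadratic resolvent of
an elliptic curve with `Δ_W > 0` — `μ₂ = 0` for real quadratic fields (`ClassicalMuVanishesRealQuadraticTwo`), the input `hk` of the
sign-free `S₃` norm-relation descent.

References: [Iwasawa1973MuInvariants] K. Iwasawa, *On the μ-invariants of ℤ_ℓ-extensions* (1973), Thm. 2/3; [Washington1997] §13.1, §13.3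
Prop. 13.23; [Lang1990] Ch. 13 §4 Lemma 4.1; [Gras2003] II.6.2.3; [NeukirchANT1999] Ch. III §1 Prop. (1.6); [Childress2009] Ch. 4 §5 Prop. 5.10.
-/

set_option autoImplicit false

noncomputable section

open scoped NumberField Classical
open NumberField NumberField.InfinitePlace Field IntermediateField IsDedekindDomain

namespace Literature.NumberTheory.IwasawaTheory

open Literature.NumberTheory.EllipticCurves Literature.NumberTheory.EllipticCurves.ZpExtension
  Literature.NumberTheory.GaloisRepresentations Literature.NumberTheory.GaloisRepresentations.Herbrand
  Literature.NumberTheory.GaloisRepresentations.MinkowskiUnit Literature.NumberTheory.GaloisRepresentations.CyclicNormIndex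
  Literature.NumberTheory.NumberFields
  Literature.NumberTheory.NumberFields.AmbiguousClass Literature.NumberTheory.NumberFields.CyclicRankBound

variable {F : Type} [Field F] [NumberField F]

/-! ## §1 Totally real bases: layers and compositums stay totally real; no ramification at infinity -/

omit [NumberField F] in
/-- **An extension of a totally real field that is unramified at the infinite places is totally real**: an infinite place `w` of `K`
over the (real) place `v` of `k` is unramified iff `w` is real or `v` is complex. [cite: NeukirchANT1999, Ch. III §1 (infinite primes; e_w ∈ {1,2})] -/
theorem isTotallyReal_of_isUnramifiedAtInfinitePlaces (k K : Type*) [Field k] [NumberField k] [IsTotallyReal k] [Field K]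
    [Algebra k K] [IsUnramifiedAtInfinitePlaces k K] : IsTotallyReal K where
  isReal w := by
    rcases isUnramified_iff.mp (InfinitePlace.isUnramified k w) with h | h
    · exact h
    · exact absurd (IsTotallyReal.isReal (w.comap (algebraMap k K))) (not_isReal_iff_isComplex.mpr h)

/-- **The layers `F_n` of ANY `ℤ_p`-extension of a totally real `F` are totally real** — `p = 2` INCLUDED: complex conjugations have
order `≤ 2` in `Gal(F̄/F)`, `ℤ_p` is torsion-free, so they lie in `ker κ` and `F_n/F` is unramified at infinity
(tree `ZpExtension.isUnramifiedAtInfinitePlaces_layer`, parity-free). [cite: Washington1997, §13.1 Prop. 13.2] -/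
theorem isTotallyReal_layer_of_isTotallyReal [IsTotallyReal F] {p : ℕ} [Fact p.Prime] (κ : ZpExtension F p) (n : ℕ) :
    IsTotallyReal ↥(κ.layer n) := by
  haveI : IsUnramifiedAtInfinitePlaces F ↥(κ.layer n) := κ.isUnramifiedAtInfinitePlaces_layer n
  exact isTotallyReal_of_isUnramifiedAtInfinitePlaces F ↥(κ.layer n)

omit [NumberField F] in
/-- The compositum of two totally real intermediate fields (inside a field algebraic over `ℚ`) is totally real
(Mathlib's `isTotallyReal_sup` for subfields, transported to `IntermediateField`). [folklore] -/
private theorem isTotallyReal_sup_intermediateField' {Ω : Type*} [Field Ω] [CharZero Ω] [Algebra F Ω]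
    [Algebra.IsAlgebraic ℚ Ω] (A B : IntermediateField F Ω) [hA : IsTotallyReal ↥A] [hB : IsTotallyReal ↥B] :
    IsTotallyReal ↥(A ⊔ B) := by
  haveI : IsTotallyReal ↥A.toSubfield := IsTotallyReal.ofRingEquiv (RingEquiv.refl ↥A)
  haveI : IsTotallyReal ↥B.toSubfield := IsTotallyReal.ofRingEquiv (RingEquiv.refl ↥B)
  have h : IsTotallyReal ↥(A.toSubfield ⊔ B.toSubfield) := isTotallyReal_sup
  exact IsTotallyReal.ofRingEquiv (RingEquiv.subfieldCongr (IntermediateField.sup_toSubfield A B).symm)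

omit [NumberField F] in
/-- **A totally real top field is unramified at the infinite places** over any base (every infinite place of it is real).
[cite: NeukirchANT1999, Ch. III §1 (infinite primes)] -/
theorem isUnramifiedAtInfinitePlaces_of_isTotallyReal (k K : Type*) [Field k] [Field K] [NumberField K] [Algebra k K]
    [IsTotallyReal K] : IsUnramifiedAtInfinitePlaces k K :=
  ⟨fun w ↦ (IsTotallyReal.isReal w).isUnramified k⟩

/-- **The layer `j'(K')·F_n` of the restricted tower is totally real** when `K'` and `F` are totally real (`κ` any `ℤ_p`-extension of `F`,
`j' : K' → F̄` over `F`): a compositum of the totally real fields `j'(K') ≅ K'` and `F_n`. [cite: Washington1997, §13.1 (the layers K·F_n of the restricted ℤ_p-extension)] -/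
theorem isTotallyReal_fieldRange_sup_layer [IsTotallyReal F] {p : ℕ} [Fact p.Prime] (κ : ZpExtension F p) (K' : Type) [Field K']
    [NumberField K'] [Algebra F K'] [IsTotallyReal K'] (j' : K' →ₐ[F] AlgebraicClosure F) (n : ℕ) :
    IsTotallyReal ↥(j'.fieldRange ⊔ κ.layer n) := by
  haveI : IsTotallyReal ↥(κ.layer n) := isTotallyReal_layer_of_isTotallyReal κ n
  haveI : IsTotallyReal ↥j'.fieldRange := IsTotallyReal.ofRingEquiv (AlgEquiv.ofInjectiveField j').toRingEquiv
  haveI : Algebra.IsAlgebraic ℚ (AlgebraicClosure F) := Algebra.IsAlgebraic.trans ℚ F (AlgebraicClosure F)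
  exact isTotallyReal_sup_intermediateField' j'.fieldRange (κ.layer n)

/-! ## §2 The ascent along a quadratic extension unramified at infinity -/

/-- ★ **Iwasawa's `μ = 0` ascends a quadratic extension at `ℓ = 2` that is unramified at the infinite places — NO unit-signature
hypothesis.** `κ` a `ℤ₂`-extension of the number field `F`; `K ⊆ K'` number fields over `F`, `[K' : K] = 2`, `κ ∘ res` onto for both
(linear disjointness from `F_∞`); `j' : K' → F̄` over `F`, `j = j'|_K`, layers `A_n = j(K)·F_n ⊆ B_n = j'(K')·F_n`. If for every `n` (i) at
most `T` primes of `A_n` ramify in `B_n` and (ii) `B_n/A_n` is unramified at the infinite places, then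
`ClassicalMuVanishes (κ|_K) ⟹ ClassicalMuVanishes (κ|_{K'})`. Finite-level proof: bounded `2`-ranks downstairs (tree
`exists_forall_classGroupPRank_le_of_classicalMuVanishes`) ⟹ per layer Chevalley's formula with archimedean factor `1`
(`archFactor_eq_one`, `padicValNat_card_fixed_add_one_le_of_archFactor`): `ord₂ #Cl(B_n)^G + 1 ≤ ord₂ h(A_n) + t_n` ⟹
`rank₂ Cl(B_n) ≤ 2(2R + T)` (module (G) `padicValNat_card_quotient_le_of_fixed`, `N ∘ i = 2`) ⟹ `μ = 0` upstairs (tree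
`classicalMuVanishes_of_forall_classGroupPRank_le`). [cite: Iwasawa1973MuInvariants, Thm. 2 and Thm. 3]
[cite: Washington1997, §13.3 Prop. 13.23] [cite: Lang1990, Ch. 13 §4 Lemma 4.1] [cite: Childress2009, Ch. 4 §5 Prop. 5.10] -/
theorem classicalMuVanishes_restrict_of_quadratic_of_isUnramifiedAtInfinitePlaces (κ : ZpExtension F 2) (K K' : Type) [Field K]
    [NumberField K] [Algebra F K] [Field K'] [NumberField K'] [Algebra F K'] [Algebra K K'] [IsScalarTower F K K']
    (hdeg : Module.finrank K K' = 2)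
    (hK : Function.Surjective (κ.toContinuousMonoidHom.comp (absGaloisRestrict F K)))
    (hK' : Function.Surjective (κ.toContinuousMonoidHom.comp (absGaloisRestrict F K')))
    (j' : K' →ₐ[F] AlgebraicClosure F) (T : ℕ)
    (hram : ∀ n : ℕ,
      letI : Algebra ↥((j'.comp (IsScalarTower.toAlgHom F K K')).fieldRange ⊔ κ.layer n) ↥(j'.fieldRange ⊔ κ.layer n) :=
        (IntermediateField.inclusion (fieldRange_comp_sup_layer_le κ K K' j' n)).toRingHom.toAlgebra
      {v : HeightOneSpectrum (𝓞 ↥((j'.comp (IsScalarTower.toAlgHom F K K')).fieldRange ⊔ κ.layer n)) |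
        v.asIdeal.ramificationIdxIn (𝓞 ↥(j'.fieldRange ⊔ κ.layer n)) ≠ 1}.ncard ≤ T)
    (hinf : ∀ n : ℕ,
      letI : Algebra ↥((j'.comp (IsScalarTower.toAlgHom F K K')).fieldRange ⊔ κ.layer n) ↥(j'.fieldRange ⊔ κ.layer n) :=
        (IntermediateField.inclusion (fieldRange_comp_sup_layer_le κ K K' j' n)).toRingHom.toAlgebra
      IsUnramifiedAtInfinitePlaces ↥((j'.comp (IsScalarTower.toAlgHom F K K')).fieldRange ⊔ κ.layer n)
        ↥(j'.fieldRange ⊔ κ.layer n))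
    (hμ : ClassicalMuVanishes (κ.restrict K hK)) :
    ClassicalMuVanishes (κ.restrict K' hK') := by
  haveI : Fact (Nat.Prime 2) := ⟨Nat.prime_two⟩
  haveI : FiniteDimensional F K := Module.Finite.of_restrictScalars_finite ℚ F K
  haveI : FiniteDimensional F K' := Module.Finite.of_restrictScalars_finite ℚ F K'
  haveI : FiniteDimensional K K' := Module.Finite.of_restrictScalars_finite F K K'
  -- bounded `2`-ranks downstairs
  obtain ⟨R, hR⟩ := exists_forall_classGroupPRank_le_of_classicalMuVanishes (κ.restrict K hK) hμ
  refine classicalMuVanishes_of_forall_classGroupPRank_le (κ.restrict K' hK') (B := 2 * (2 * R + T)) fun n ↦ ?_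
  -- the layers `A = j(K)·F_n ⊆ B = j'(K')·F_n`
  set j : K →ₐ[F] AlgebraicClosure F := j'.comp (IsScalarTower.toAlgHom F K K') with hj
  set A : IntermediateField F (AlgebraicClosure F) := j.fieldRange ⊔ κ.layer n with hA
  set B : IntermediateField F (AlgebraicClosure F) := j'.fieldRange ⊔ κ.layer n with hB
  have hAB : A ≤ B := fieldRange_comp_sup_layer_le κ K K' j' n
  haveI : NumberField ↥A := numberField_fieldRange_sup_layer κ K j n
  haveI : NumberField ↥B := numberField_fieldRange_sup_layer κ K' j' n
  letI : Algebra ↥A ↥B := (IntermediateField.inclusion hAB).toRingHom.toAlgebra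
  haveI : IsScalarTower F ↥A ↥B := IsScalarTower.of_algebraMap_eq fun x ↦ rfl
  haveI : Module.Free ↥A ↥B := Module.Free.of_divisionRing ↥A ↥B
  haveI : FiniteDimensional ↥A ↥B := Module.Finite.of_restrictScalars_finite F ↥A ↥B
  haveI : IsUnramifiedAtInfinitePlaces ↥A ↥B := hinf n
  -- `[B : A] = [K' : K] = 2`
  have hdA : Module.finrank F ↥A = Module.finrank F K * 2 ^ n := finrank_fieldRange_sup_layer κ K hK j n
  have hdB : Module.finrank F ↥B = Module.finrank F K' * 2 ^ n := finrank_fieldRange_sup_layer κ K' hK' j' n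
  have hdegAB : Module.finrank ↥A ↥B = 2 := by
    have htower := Module.finrank_mul_finrank F ↥A ↥B
    have hKK' := Module.finrank_mul_finrank F K K'
    have hA0 : 0 < Module.finrank F ↥A := Module.finrank_pos
    have h1 : Module.finrank F ↥A * Module.finrank ↥A ↥B = Module.finrank F ↥A * 2 := by
      rw [htower, hdB, hdA, ← hKK', hdeg]; ring
    exact Nat.eq_of_mul_eq_mul_left hA0 h1
  haveI : Algebra.IsQuadraticExtension ↥A ↥B := ⟨hdegAB⟩
  haveI : IsGalois ↥A ↥B := inferInstance
  -- a generator of `Gal(B/A) ≅ C₂`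
  obtain ⟨σ, hσ⟩ := IsCyclic.exists_generator (α := ↥B ≃ₐ[↥A] ↥B)
  have hcard : Fintype.card (↥B ≃ₐ[↥A] ↥B) = 2 := by
    rw [← Nat.card_eq_fintype_card, IsGalois.card_aut_eq_finrank, hdegAB]
  have hσ2 : σ * σ = 1 := by rw [← pow_two, ← hcard, pow_card_eq_one]
  -- module (L): Chevalley as a `2`-adic inequality on this layer — archimedean factor `1`, no unit index needed
  have harch : padicValNat 2 (ArchHerbrand.archFactor ↥A ↥B) ≤
      padicValNat 2 ((unitsE ↥B ⊓ (⊤ : Subgroup (↥B)ˣ).map (Herbrand.norm (↥B ≃ₐ[↥A] ↥B))).relIndex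
        (unitsE ↥B ⊓ (unitsIncl ↥A ↥B).range)) := by
    rw [archFactor_eq_one, padicValNat_one_right]
    exact Nat.zero_le _
  have hchev := padicValNat_card_fixed_add_one_le_of_archFactor (K := ↥A) (L := ↥B) Nat.prime_two hdegAB hσ harch
  have htn : {v : HeightOneSpectrum (𝓞 ↥A) | v.asIdeal.ramificationIdxIn (𝓞 ↥B) ≠ 1}.ncard ≤ T := hram n
  -- the action on `Cl(B)` and its fixed classes
  set f : ClassGroup (𝓞 ↥B) ≃* ClassGroup (𝓞 ↥B) := ClassGroup.mulEquiv (intAut σ) with hf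
  have hfixed : Nat.card {c : ClassGroup (𝓞 ↥B) // ∀ τ : ↥B ≃ₐ[↥A] ↥B, ClassGroup.mulEquiv (intAut τ) c = c} =
      Nat.card (f.toMonoidHom.eqLocus (MonoidHom.id _)) :=
    natCard_fixed_eq_natCard_eqLocus_of_generator (fun τ : ↥B ≃ₐ[↥A] ↥B ↦ ClassGroup.mulEquiv (intAut τ))
      mulEquiv_intAut_one mulEquiv_intAut_mul hσ
  have hff : ∀ b : ClassGroup (𝓞 ↥B), (⇑f.toMonoidHom)^[2] b = b := fun b ↦ by
    rw [Function.iterate_succ_apply, Function.iterate_one, MulEquiv.coe_toMonoidHom, hf, ← MulEquiv.trans_apply,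
      ← mulEquiv_intAut_mul, hσ2, mulEquiv_intAut_one, MulEquiv.refl_apply]
  -- module (G): the rank bound
  have hNj : ∀ a : ClassGroup (𝓞 ↥A), classGroupNorm ↥A ↥B (classGroupExtend ↥A ↥B a) = a ^ 2 := fun a ↦ by
    rw [classGroupNorm_classGroupExtend, hdegAB]
  have hjfix : ∀ a : ClassGroup (𝓞 ↥A), f.toMonoidHom (classGroupExtend ↥A ↥B a) = classGroupExtend ↥A ↥B a := fun a ↦ by
    rw [MulEquiv.coe_toMonoidHom, hf, mulEquiv_intAut_classGroupExtend]
  have hfix : padicValNat 2 (Nat.card (f.toMonoidHom.eqLocus (MonoidHom.id _))) ≤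
      padicValNat 2 (Nat.card (ClassGroup (𝓞 ↥A))) + T := by
    rw [← hfixed]
    have hcl : classNumber ↥A = Nat.card (ClassGroup (𝓞 ↥A)) := by
      rw [classNumber, Nat.card_eq_fintype_card]
    rw [← hcl]
    omega
  have hrank := padicValNat_card_quotient_le_of_fixed 2 f.toMonoidHom hff (classGroupExtend ↥A ↥B) (classGroupNorm ↥A ↥B)
    hNj hjfix T hfix
  -- transport to the layers of the restricted towers
  rw [classGroupPRank_restrict_eq κ K' hK' j' n]
  have hRn := hR n
  rw [classGroupPRank_restrict_eq κ K hK j n] at hRn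
  calc padicValNat 2 (Nat.card (ClassGroup (𝓞 ↥B) ⧸ (powMonoidHom 2 : ClassGroup (𝓞 ↥B) →* _).range))
      ≤ 2 * (2 * padicValNat 2 (Nat.card (ClassGroup (𝓞 ↥A) ⧸ (powMonoidHom 2 : ClassGroup (𝓞 ↥A) →* _).range)) + T) := hrank
    _ ≤ 2 * (2 * R + T) := by
        apply Nat.mul_le_mul_left
        exact Nat.add_le_add_right (Nat.mul_le_mul_left 2 hRn) T

/-! ## §3 Totally real data: the archimedean hypothesis discharged -/

/-- ★ **Iwasawa's `μ = 0` ascends a quadratic extension at `ℓ = 2` with `F` and `K'` TOTALLY REAL.** `κ` a `ℤ₂`-extension of the totally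
real number field `F`; `K ⊆ K'` over `F` with `K'` totally real, `[K' : K] = 2`, `κ ∘ res` onto for both; at most `T` primes of
`A_n = j(K)·F_n` ramified in `B_n = j'(K')·F_n` for every `n`. Then `ClassicalMuVanishes (κ|_K) ⟹ ClassicalMuVanishes (κ|_{K'})`:
every `B_n` is totally real (`F_n` totally real, §1), so `B_n/A_n` is unramified at infinity and §2 applies.
[cite: Iwasawa1973MuInvariants, Thm. 2 and Thm. 3] [cite: Washington1997, §13.3 Prop. 13.23] [cite: Lang1990, Ch. 13 §4 Lemma 4.1] -/
theorem classicalMuVanishes_restrict_of_quadratic_of_isTotallyReal [IsTotallyReal F] (κ : ZpExtension F 2) (K K' : Type) [Field K]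
    [NumberField K] [Algebra F K] [Field K'] [NumberField K'] [Algebra F K'] [Algebra K K'] [IsScalarTower F K K']
    [IsTotallyReal K'] (hdeg : Module.finrank K K' = 2)
    (hK : Function.Surjective (κ.toContinuousMonoidHom.comp (absGaloisRestrict F K)))
    (hK' : Function.Surjective (κ.toContinuousMonoidHom.comp (absGaloisRestrict F K')))
    (j' : K' →ₐ[F] AlgebraicClosure F) (T : ℕ)
    (hram : ∀ n : ℕ,
      letI : Algebra ↥((j'.comp (IsScalarTower.toAlgHom F K K')).fieldRange ⊔ κ.layer n) ↥(j'.fieldRange ⊔ κ.layer n) :=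
        (IntermediateField.inclusion (fieldRange_comp_sup_layer_le κ K K' j' n)).toRingHom.toAlgebra
      {v : HeightOneSpectrum (𝓞 ↥((j'.comp (IsScalarTower.toAlgHom F K K')).fieldRange ⊔ κ.layer n)) |
        v.asIdeal.ramificationIdxIn (𝓞 ↥(j'.fieldRange ⊔ κ.layer n)) ≠ 1}.ncard ≤ T)
    (hμ : ClassicalMuVanishes (κ.restrict K hK)) :
    ClassicalMuVanishes (κ.restrict K' hK') := by
  haveI : Fact (Nat.Prime 2) := ⟨Nat.prime_two⟩
  refine classicalMuVanishes_restrict_of_quadratic_of_isUnramifiedAtInfinitePlaces κ K K' hdeg hK hK' j' T hram (fun n ↦ ?_) hμ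
  letI : Algebra ↥((j'.comp (IsScalarTower.toAlgHom F K K')).fieldRange ⊔ κ.layer n) ↥(j'.fieldRange ⊔ κ.layer n) :=
    (IntermediateField.inclusion (fieldRange_comp_sup_layer_le κ K K' j' n)).toRingHom.toAlgebra
  haveI : NumberField ↥(j'.fieldRange ⊔ κ.layer n) := numberField_fieldRange_sup_layer κ K' j' n
  -- `B_n = j'(K') ⊔ F_n` is totally real
  haveI : IsTotallyReal ↥(j'.fieldRange ⊔ κ.layer n) := isTotallyReal_fieldRange_sup_layer κ K' j' n
  exact isUnramifiedAtInfinitePlaces_of_isTotallyReal _ _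

/-! ## §4 Base form: `F_n ⊆ j'(K')·F_n` for a quadratic `K'/F` unramified at infinity (the `p = 2` twin of the odd cyclic ascent) -/

/-- **Per-layer rank bound, base form, no `μ`-hypothesis.** `κ` a `ℤ₂`-extension of `F`, `K'/F` quadratic (`[K' : F] = 2`) with
`κ ∘ res_{K'/F}` onto, `j' : K' → F̄`; if at most `T` primes of `F_n` ramify in `B_n = j'(K')·F_n` and `B_n/F_n` is unramified at the
infinite places, then `rank₂ Cl((K'F_∞)_n) ≤ 2·(2·rank₂ Cl(F_n) + T)` — Chevalley with archimedean factor `1`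
(`padicValNat_card_fixed_add_one_le_of_archFactor`, `archFactor_eq_one`) and the `(σ − 1)`-filtration (module (G)).
[cite: Iwasawa1973MuInvariants, Thm. 2 and its proof (§2)] [cite: Lang1990, Ch. 13 §4 Lemma 4.1–4.2]
[cite: NeukirchANT1999, Ch. III §1 Prop. (1.6) (ii), (iv)] -/
theorem classGroupPRank_restrict_le_of_finrank_eq_two_of_isUnramifiedAtInfinitePlaces (κ : ZpExtension F 2) (K' : Type)
    [Field K'] [NumberField K'] [Algebra F K'] (hdeg : Module.finrank F K' = 2)
    (hK' : Function.Surjective (κ.toContinuousMonoidHom.comp (absGaloisRestrict F K')))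
    (j' : K' →ₐ[F] AlgebraicClosure F) (n T : ℕ)
    (hram :
      letI : Algebra ↥(κ.layer n) ↥(j'.fieldRange ⊔ κ.layer n) :=
        (IntermediateField.inclusion (le_sup_right : κ.layer n ≤ j'.fieldRange ⊔ κ.layer n)).toRingHom.toAlgebra
      {v : HeightOneSpectrum (𝓞 ↥(κ.layer n)) |
        v.asIdeal.ramificationIdxIn (𝓞 ↥(j'.fieldRange ⊔ κ.layer n)) ≠ 1}.ncard ≤ T)
    (hinf :
      letI : Algebra ↥(κ.layer n) ↥(j'.fieldRange ⊔ κ.layer n) :=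
        (IntermediateField.inclusion (le_sup_right : κ.layer n ≤ j'.fieldRange ⊔ κ.layer n)).toRingHom.toAlgebra
      IsUnramifiedAtInfinitePlaces ↥(κ.layer n) ↥(j'.fieldRange ⊔ κ.layer n)) :
    classGroupPRank (κ.restrict K' hK') n ≤ 2 * (2 * classGroupPRank κ n + T) := by
  haveI : Fact (Nat.Prime 2) := ⟨Nat.prime_two⟩
  haveI : FiniteDimensional F K' := Module.Finite.of_restrictScalars_finite ℚ F K'
  haveI : Algebra.IsQuadraticExtension F K' := ⟨hdeg⟩
  haveI : IsGalois F K' := inferInstance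
  -- the layers `A = F_n ⊆ B = j'(K')·F_n`
  set A : IntermediateField F (AlgebraicClosure F) := κ.layer n with hA
  set B : IntermediateField F (AlgebraicClosure F) := j'.fieldRange ⊔ κ.layer n with hB
  have hAB : A ≤ B := le_sup_right
  haveI : FiniteDimensional F ↥A := κ.finiteDimensional_layer_holds n
  haveI : NumberField ↥A := NumberField.of_module_finite F ↥A
  haveI : NumberField ↥B := numberField_fieldRange_sup_layer κ K' j' n
  letI : Algebra ↥A ↥B := (IntermediateField.inclusion hAB).toRingHom.toAlgebra
  haveI : IsScalarTower F ↥A ↥B := IsScalarTower.of_algebraMap_eq fun _ ↦ rfl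
  haveI : Module.Free ↥A ↥B := Module.Free.of_divisionRing ↥A ↥B
  haveI : FiniteDimensional ↥A ↥B := Module.Finite.of_restrictScalars_finite F ↥A ↥B
  haveI : IsUnramifiedAtInfinitePlaces ↥A ↥B := hinf
  -- `[B : A] = 2`, `B/A` Galois, cyclic
  have hdegAB : Module.finrank ↥A ↥B = 2 := by
    rw [← hdeg]; exact finrank_layer_fieldRange_sup_layer κ K' hK' j' n
  haveI : IsGalois ↥A ↥B := isGalois_layer_fieldRange_sup_layer κ K' j' n
  have hcard : Nat.card (↥B ≃ₐ[↥A] ↥B) = 2 := by rw [IsGalois.card_aut_eq_finrank, hdegAB]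
  haveI : IsCyclic (↥B ≃ₐ[↥A] ↥B) := isCyclic_of_prime_card hcard
  obtain ⟨σ, hσ⟩ := IsCyclic.exists_generator (α := ↥B ≃ₐ[↥A] ↥B)
  have hσp : σ ^ 2 = 1 := by rw [← hcard]; exact pow_card_eq_one'
  -- Chevalley on this layer: archimedean factor `1`, no unit index needed
  have harch : padicValNat 2 (ArchHerbrand.archFactor ↥A ↥B) ≤
      padicValNat 2 ((unitsE ↥B ⊓ (⊤ : Subgroup (↥B)ˣ).map (Herbrand.norm (↥B ≃ₐ[↥A] ↥B))).relIndex
        (unitsE ↥B ⊓ (unitsIncl ↥A ↥B).range)) := by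
    rw [archFactor_eq_one, padicValNat_one_right]
    exact Nat.zero_le _
  have hchev := padicValNat_card_fixed_add_one_le_of_archFactor (K := ↥A) (L := ↥B) Nat.prime_two hdegAB hσ harch
  -- the action on `Cl(B)` and its fixed classes
  set f : ClassGroup (𝓞 ↥B) ≃* ClassGroup (𝓞 ↥B) := ClassGroup.mulEquiv (intAut σ) with hf
  have hfixed : Nat.card {c : ClassGroup (𝓞 ↥B) // ∀ τ : ↥B ≃ₐ[↥A] ↥B, ClassGroup.mulEquiv (intAut τ) c = c} =
      Nat.card (f.toMonoidHom.eqLocus (MonoidHom.id _)) :=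
    natCard_fixed_eq_natCard_eqLocus_of_generator (fun τ : ↥B ≃ₐ[↥A] ↥B ↦ ClassGroup.mulEquiv (intAut τ))
      mulEquiv_intAut_one mulEquiv_intAut_mul hσ
  have hff : ∀ b : ClassGroup (𝓞 ↥B), (⇑f.toMonoidHom)^[2] b = b := fun b ↦ by
    rw [hf, iterate_mulEquiv_intAut_eq_pow, hσp, mulEquiv_intAut_one, MulEquiv.refl_apply]
  -- module (G): the rank bound
  have hNj : ∀ a : ClassGroup (𝓞 ↥A), classGroupNorm ↥A ↥B (classGroupExtend ↥A ↥B a) = a ^ 2 := fun a ↦ by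
    rw [classGroupNorm_classGroupExtend, hdegAB]
  have hjfix : ∀ a : ClassGroup (𝓞 ↥A), f.toMonoidHom (classGroupExtend ↥A ↥B a) = classGroupExtend ↥A ↥B a :=
    fun a ↦ by rw [MulEquiv.coe_toMonoidHom, hf, mulEquiv_intAut_classGroupExtend]
  have hfix : padicValNat 2 (Nat.card (f.toMonoidHom.eqLocus (MonoidHom.id _))) ≤
      padicValNat 2 (Nat.card (ClassGroup (𝓞 ↥A))) + T := by
    rw [← hfixed]
    have hcl : classNumber ↥A = Nat.card (ClassGroup (𝓞 ↥A)) := by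
      rw [classNumber, Nat.card_eq_fintype_card]
    rw [← hcl]
    have htn : {v : HeightOneSpectrum (𝓞 ↥A) | v.asIdeal.ramificationIdxIn (𝓞 ↥B) ≠ 1}.ncard ≤ T := hram
    omega
  have hrank := padicValNat_card_quotient_le_of_fixed 2 f.toMonoidHom hff (classGroupExtend ↥A ↥B)
    (classGroupNorm ↥A ↥B) hNj hjfix T hfix
  -- transport to the layers of the restricted tower
  rw [classGroupPRank_restrict_eq κ K' hK' j' n, classGroupPRank_def]
  exact hrank

/-- ★ **`μ = 0` ascends a quadratic extension unramified at infinity — base form.** `κ` a `ℤ₂`-extension of `F`, `K'/F` quadratic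
with `κ ∘ res_{K'/F}` onto (`K' ∩ F_∞ = F`), `j' : K' → F̄`; if for every `n` at most `T` primes of `F_n` ramify in `j'(K')·F_n` and
`j'(K')·F_n / F_n` is unramified at the infinite places, then `ClassicalMuVanishes κ ⟹ ClassicalMuVanishes (κ|_{K'})` (growth form
of `μ = 0`; per layer `rank₂ Cl((K'F_∞)_n) ≤ 2(2R + T)`). Iwasawa's Thm. 2 at `ℓ = 2` with nothing ramified at infinity.
[cite: Iwasawa1973MuInvariants, Thm. 2 and Thm. 3] [cite: Washington1997, §13.3 Prop. 13.23] [cite: Lang1990, Ch. 13 §4 Lemma 4.1–4.2] -/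
theorem classicalMuVanishes_restrict_of_finrank_eq_two_of_isUnramifiedAtInfinitePlaces (κ : ZpExtension F 2) (K' : Type)
    [Field K'] [NumberField K'] [Algebra F K'] (hdeg : Module.finrank F K' = 2)
    (hK' : Function.Surjective (κ.toContinuousMonoidHom.comp (absGaloisRestrict F K')))
    (j' : K' →ₐ[F] AlgebraicClosure F) (T : ℕ)
    (hram : ∀ n : ℕ,
      letI : Algebra ↥(κ.layer n) ↥(j'.fieldRange ⊔ κ.layer n) :=
        (IntermediateField.inclusion (le_sup_right : κ.layer n ≤ j'.fieldRange ⊔ κ.layer n)).toRingHom.toAlgebra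
      {v : HeightOneSpectrum (𝓞 ↥(κ.layer n)) |
        v.asIdeal.ramificationIdxIn (𝓞 ↥(j'.fieldRange ⊔ κ.layer n)) ≠ 1}.ncard ≤ T)
    (hinf : ∀ n : ℕ,
      letI : Algebra ↥(κ.layer n) ↥(j'.fieldRange ⊔ κ.layer n) :=
        (IntermediateField.inclusion (le_sup_right : κ.layer n ≤ j'.fieldRange ⊔ κ.layer n)).toRingHom.toAlgebra
      IsUnramifiedAtInfinitePlaces ↥(κ.layer n) ↥(j'.fieldRange ⊔ κ.layer n))
    (hμ : ClassicalMuVanishes κ) :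
    ClassicalMuVanishes (κ.restrict K' hK') := by
  haveI : Fact (Nat.Prime 2) := ⟨Nat.prime_two⟩
  obtain ⟨R, hR⟩ := exists_forall_classGroupPRank_le_of_classicalMuVanishes κ hμ
  refine classicalMuVanishes_of_forall_classGroupPRank_le (κ.restrict K' hK') (B := 2 * (2 * R + T)) fun n ↦ ?_
  calc classGroupPRank (κ.restrict K' hK') n ≤ 2 * (2 * classGroupPRank κ n + T) :=
        classGroupPRank_restrict_le_of_finrank_eq_two_of_isUnramifiedAtInfinitePlaces κ K' hdeg hK' j' n T (hram n) (hinf n)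
    _ ≤ 2 * (2 * R + T) := Nat.mul_le_mul_left _ (Nat.add_le_add_right (Nat.mul_le_mul_left 2 (hR n)) T)

/-- ★ **`μ = 0` ascends a quadratic extension with `F` and `K'` totally real — base form.** `κ` a `ℤ₂`-extension of the totally real
`F`, `K'/F` quadratic and totally real with `κ ∘ res_{K'/F}` onto, `j' : K' → F̄`, at most `T` primes of `F_n` ramified in `j'(K')·F_n` for
every `n`: `ClassicalMuVanishes κ ⟹ ClassicalMuVanishes (κ|_{K'})` (the layers `j'(K')·F_n` are totally real, §1).
[cite: Iwasawa1973MuInvariants, Thm. 2 and Thm. 3] [cite: Washington1997, §13.3 Prop. 13.23] -/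
theorem classicalMuVanishes_restrict_of_finrank_eq_two_of_isTotallyReal [IsTotallyReal F] (κ : ZpExtension F 2) (K' : Type)
    [Field K'] [NumberField K'] [Algebra F K'] [IsTotallyReal K'] (hdeg : Module.finrank F K' = 2)
    (hK' : Function.Surjective (κ.toContinuousMonoidHom.comp (absGaloisRestrict F K')))
    (j' : K' →ₐ[F] AlgebraicClosure F) (T : ℕ)
    (hram : ∀ n : ℕ,
      letI : Algebra ↥(κ.layer n) ↥(j'.fieldRange ⊔ κ.layer n) :=
        (IntermediateField.inclusion (le_sup_right : κ.layer n ≤ j'.fieldRange ⊔ κ.layer n)).toRingHom.toAlgebra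
      {v : HeightOneSpectrum (𝓞 ↥(κ.layer n)) |
        v.asIdeal.ramificationIdxIn (𝓞 ↥(j'.fieldRange ⊔ κ.layer n)) ≠ 1}.ncard ≤ T)
    (hμ : ClassicalMuVanishes κ) :
    ClassicalMuVanishes (κ.restrict K' hK') := by
  haveI : Fact (Nat.Prime 2) := ⟨Nat.prime_two⟩
  refine classicalMuVanishes_restrict_of_finrank_eq_two_of_isUnramifiedAtInfinitePlaces κ K' hdeg hK' j' T hram (fun n ↦ ?_) hμ
  letI : Algebra ↥(κ.layer n) ↥(j'.fieldRange ⊔ κ.layer n) :=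
    (IntermediateField.inclusion (le_sup_right : κ.layer n ≤ j'.fieldRange ⊔ κ.layer n)).toRingHom.toAlgebra
  haveI : NumberField ↥(j'.fieldRange ⊔ κ.layer n) := numberField_fieldRange_sup_layer κ K' j' n
  haveI : IsTotallyReal ↥(j'.fieldRange ⊔ κ.layer n) := isTotallyReal_fieldRange_sup_layer κ K' j' n
  exact isUnramifiedAtInfinitePlaces_of_isTotallyReal _ _

end Literature.NumberTheory.IwasawaTheory

end
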